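import Mathlib
import Literature.Analysis.Fourier.HilbertTransformLineSpectrum
import HarnessLib

/-!
# Tricomi–Cotlar product rule for the Hilbert transform on the line: `H(f·Hf) = ½((Hf)² − f²)`

`Literature/Analysis/Fourier`. For a real function `f` on `ℝ` (continuous, bounded, in `L¹ ∩ L²`, with continuous Hilbert
transform `Hf` and `𝓕f ∈ L¹`; tree conventions `hilbertTransform`, `H cos = sin`), the classical product rule
  `H(f · Hf)(x) = ½((Hf)(x)² − f(x)²)`      (`hilbertTransform_mul_hilbertTransform`)
— the «`f = g`» case of Tricomi's identity `H(fHg + gHf) = Hf·Hg − f·g`, equivalently: the square of the analytic signal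
`W = f + iHf` is again an analytic signal, `Im W² = H(Re W²)`, `Re W² = −H(Im W²)`.
[cite: King2009HilbertTransforms2, eqs. (19.283)–(19.284) (the two components of the squared analytic signal; «follows
directly from the Tricomi identity, Eq. (4.270)»)].
PROOF (Fourier side, no `L²`-Fourier transform, no principal-value exchange): by `analyticSignal_eq_fourierInv`
(`HilbertTransformLineSpectrum.lean`) `W = 𝓕⁻G` with `G = (1 + sgn)𝓕f ∈ L¹` vanishing on `k < 0`. With the ANALYTIC
REGULARISERS `ψ_n = 𝓕⁻ρ_n`, `ρ_n` a normalised smooth bump supported in `(1/(n+1), 3/(n+1))` (`|ψ_n| ≤ 1`, `ψ_n → 1`,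
`ψ_n ∈ 𝓢`), the convolution theorem `𝓕(𝓕⁻G · h) = G ⋆ 𝓕h` (`fourier_fourierInv_mul_eq_convolution`) gives
`𝓕(W²ψ_n) = G ⋆ (G ⋆ ρ_n)`, which vanishes on `k ≤ 0` because all supports lie in `[0, ∞)`; dominated convergence
(`|W²ψ_n| ≤ |W|² ∈ L¹`) gives `𝓕(W²)(k) = 0` for `k ≤ 0`. Writing `W² = A + iB`, `A = f² − (Hf)²`, `B = 2f·Hf` (real, `L¹`),
Hermitian symmetry `𝓕A(−k) = conj 𝓕A(k)` turns this into `𝓕A = (i sgn k)·𝓕B` off `k = 0`, i.e. `𝓕A = −(−i sgn)𝓕B`; the tested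
multiplier identity `∫ HB·𝓕θ = ∫ (−i sgn)𝓕B·θ` then gives `∫ (HB + A)𝓕θ = 0` for every Schwartz `θ`, so `HB = −A` by
continuity, which is the claim. The regularity of `Hf` and of `H(f·Hf)` (continuity; a.e. integrability of the p.v.
integrand of `B`) is ASSUMED here and supplied by the user (for `C²` profiles: `HilbertTransformLineDeriv.lean`).
MOTIVATION (cell ns-blowup, zone Z3, MODEL): the Schochet-corner classification of the viscous CLM profile equation
`(HΩ)Ω + εΩ″ = 0` (`Summits/…/SheetNSLineCorner*`). WHAT THIS IS NOT: not Navier–Stokes. No definitions.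
-/

namespace Literature.Analysis.Fourier

open _root_.MeasureTheory Set Filter _root_.Complex SchwartzMap
open Literature.NumberTheory.ConnesConsani2021 Literature.Analysis.FunctionSpaces
open scoped Real Topology ENNReal FourierTransform _root_.Convolution

/-! ### Plumbing -/

/-- `Real.sign` is measurable. [folklore] -/
private theorem measurable_real_sign' : Measurable Real.sign := by
  have : Real.sign = fun r : ℝ => if r < 0 then (-1 : ℝ) else if 0 < r then 1 else 0 := by
    funext r; rfl
  rw [this]
  exact Measurable.ite measurableSet_Iio measurable_const
    (Measurable.ite measurableSet_Ioi measurable_const measurable_const)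

/-- Integrability of the Fourier integrand `𝐞(−vw)·a(v)` for `a ∈ L¹`. [folklore] -/
private theorem integrable_char_mul {a : ℝ → ℂ} (ha : Integrable a) (w : ℝ) :
    Integrable (fun v : ℝ => ((𝐞 (-(v * w)) : Circle) : ℂ) * a v) := by
  have hc : Continuous fun v : ℝ => ((𝐞 (-(v * w)) : Circle) : ℂ) :=
    continuous_subtype_val.comp (Real.continuous_fourierChar.comp (by fun_prop))
  exact ha.bdd_mul hc.aestronglyMeasurable (ae_of_all _ fun v => (Circle.norm_coe _).le)

/-- Integrability of the Fourier integrand `𝐞(−vw) • a(v)` (scalar action of the circle) for `a ∈ L¹`. [folklore] -/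
private theorem integrable_char_smul {a : ℝ → ℂ} (ha : Integrable a) (w : ℝ) :
    Integrable (fun v : ℝ => (𝐞 (-(v * w))) • a v) := by
  have h := integrable_char_mul ha w
  simpa only [Circle.smul_def, smul_eq_mul] using h

/-- Hermitian symmetry of the Fourier transform of a REAL function: `𝓕a(−k) = conj(𝓕a(k))`. [folklore] -/
private theorem fourier_ofReal_neg {a : ℝ → ℝ} (k : ℝ) :
    𝓕 (fun x => (a x : ℂ)) (-k) = starRingEnd ℂ (𝓕 (fun x => (a x : ℂ)) k) := by
  rw [Real.fourier_real_eq, Real.fourier_real_eq, ← integral_conj]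
  refine integral_congr_ae (ae_of_all _ fun v => ?_)
  simp only [Circle.smul_def, smul_eq_mul, map_mul, Complex.conj_ofReal]
  congr 1
  rw [← Circle.coe_inv_eq_conj, ← AddChar.map_neg_eq_inv]
  simp only [mul_neg, neg_neg]

/-- Support of a convolution on the line: if `F = 0` on `(−∞,0)` and `g = 0` on `(−∞, a]`, then `F ⋆ g = 0` on `(−∞, a]`
(pointwise: the integrand vanishes identically). [folklore] -/
private theorem convolution_eq_zero_of_le {F g : ℝ → ℂ} {a : ℝ} (hF : ∀ s < 0, F s = 0) (hg : ∀ t ≤ a, g t = 0)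
    {k : ℝ} (hk : k ≤ a) : (F ⋆[ContinuousLinearMap.mul ℂ ℂ] g) k = 0 := by
  rw [convolution_def]
  refine (integral_congr_ae (ae_of_all _ fun s => ?_)).trans (integral_zero ℝ ℂ)
  simp only [ContinuousLinearMap.mul_apply']
  rcases lt_or_ge s 0 with hs | hs
  · rw [hF s hs, zero_mul]
  · rw [hg (k - s) (by linarith), mul_zero]

/-! ### Analytic regularisers `ψ_n = 𝓕⁻ρ_n`, `ρ_n` a normalised bump in `(1/(n+1), 3/(n+1))` -/

/-- **Analytic regularisers.** There are `ψ_n, ρ_n : ℝ → ℂ` (`n : ℕ`) with `ψ_n` continuous and integrable, `|ψ_n| ≤ 1`,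
`ψ_n(x) → 1` for every `x`, `𝓕ψ_n = ρ_n`, `ρ_n ∈ L¹` and `ρ_n = 0` on `(−∞, 0]` (indeed off `(1/(n+1), 3/(n+1))`):
`ρ_n` = normalised smooth bump of radius `1/(n+1)` centred at `2/(n+1)` and `ψ_n = 𝓕⁻ρ_n`. [folklore] -/
private theorem exists_analyticRegularisers :
    ∃ ψ ρ : ℕ → ℝ → ℂ, (∀ n, Continuous (ψ n)) ∧ (∀ n, Integrable (ψ n)) ∧ (∀ n, MemLp (ψ n) 2) ∧
      (∀ n x, ‖ψ n x‖ ≤ 1) ∧ (∀ x, Tendsto (fun n => ψ n x) atTop (𝓝 1)) ∧ (∀ n, Integrable (ρ n)) ∧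
      (∀ n, 𝓕 (ψ n) = ρ n) ∧ (∀ n k, k ≤ 0 → ρ n k = 0) := by
  -- the bumps
  have hb : ∀ n : ℕ, ∃ b : ContDiffBump ((2 : ℝ) / ((n : ℝ) + 1)), b.rOut = 1 / ((n : ℝ) + 1) := fun n =>
    ⟨⟨1 / (2 * ((n : ℝ) + 1)), 1 / ((n : ℝ) + 1), by positivity,
      by rw [div_lt_div_iff_of_pos_left one_pos (by positivity) (by positivity)]; linarith [show (0:ℝ) < (n:ℝ) + 1 by positivity]⟩,
     rfl⟩
  choose b hb using hb
  -- `ρ_n` as a Schwartz map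
  set ρr : ℕ → ℝ → ℝ := fun n => (b n).normed volume with hρr
  have hρc : ∀ n, ContDiff ℝ (⊤ : ℕ∞) (fun k => ((ρr n k : ℝ) : ℂ)) := fun n =>
    Complex.ofRealCLM.contDiff.comp (b n).contDiff_normed
  have hρs : ∀ n, HasCompactSupport (fun k => ((ρr n k : ℝ) : ℂ)) := fun n =>
    ((b n).hasCompactSupport_normed).comp_left Complex.ofReal_zero
  set ρS : ℕ → 𝓢(ℝ, ℂ) := fun n => (hρs n).toSchwartzMap (hρc n) with hρS
  have hρS_coe : ∀ n, ((ρS n : 𝓢(ℝ, ℂ)) : ℝ → ℂ) = fun k => ((ρr n k : ℝ) : ℂ) := fun n => rfl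
  set ψ : ℕ → ℝ → ℂ := fun n => ((𝓕⁻ (ρS n) : 𝓢(ℝ, ℂ)) : ℝ → ℂ) with hψ
  have hψ_eq : ∀ n, ψ n = 𝓕⁻ (fun k => ((ρr n k : ℝ) : ℂ)) := fun n => by
    simp only [hψ]; rw [SchwartzMap.fourierInv_coe, hρS_coe]
  refine ⟨ψ, fun n k => ((ρr n k : ℝ) : ℂ), fun n => (𝓕⁻ (ρS n)).continuous, fun n => (𝓕⁻ (ρS n)).integrable,
    fun n => (𝓕⁻ (ρS n)).memLp 2, ?_, ?_, fun n => by simpa [hρS_coe] using (ρS n).integrable, ?_, ?_⟩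
  · -- `|ψ_n| ≤ ∫ ρ_n = 1`
    intro n x
    rw [hψ_eq n, Real.fourierInv_eq_fourier_neg]
    refine (VectorFourier.norm_fourierIntegral_le_integral_norm 𝐞 volume (innerₗ ℝ) _ (-x)).trans ?_
    have : ∫ k, ‖((ρr n k : ℝ) : ℂ)‖ = ∫ k, ρr n k := by
      congr 1 with k; rw [Complex.norm_real, Real.norm_eq_abs, abs_of_nonneg ((b n).nonneg_normed k)]
    rw [this, hρr, (b n).integral_normed]
  · -- `ψ_n(x) → 1`: `‖ψ_n(x) − 1‖ ≤ 2π|x|·3/(n+1)`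
    intro x
    rw [tendsto_iff_norm_sub_tendsto_zero]
    have hrate : Tendsto (fun n : ℕ => 2 * π * |x| * (3 / ((n : ℝ) + 1))) atTop (𝓝 0) := by
      have h := (tendsto_one_div_add_atTop_nhds_zero_nat).const_mul (2 * π * |x| * 3)
      rw [mul_zero] at h
      refine h.congr fun n => ?_; ring
    refine squeeze_zero (fun n => norm_nonneg _) (fun n => ?_) hrate
    -- `ψ_n x − 1 = ∫ (𝐞(kx) − 1) ρ_n(k) dk`
    have hρi : Integrable (fun k => ((ρr n k : ℝ) : ℂ)) := by simpa [hρS_coe] using (ρS n).integrable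
    have h1 : ∫ k, ((ρr n k : ℝ) : ℂ) = 1 := by
      rw [integral_complex_ofReal, hρr, (b n).integral_normed]; simp
    have hci : Integrable (fun k => ((𝐞 (k * x) : Circle) : ℂ) * ((ρr n k : ℝ) : ℂ)) := by
      have hc : Continuous fun k : ℝ => ((𝐞 (k * x) : Circle) : ℂ) :=
        continuous_subtype_val.comp (Real.continuous_fourierChar.comp (by fun_prop))
      exact hρi.bdd_mul hc.aestronglyMeasurable (ae_of_all _ fun v => (Circle.norm_coe _).le)
    have hrepr : ψ n x - 1 = ∫ k, (((𝐞 (k * x) : Circle) : ℂ) - 1) * ((ρr n k : ℝ) : ℂ) := by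
      rw [hψ_eq n, fourierInv_real_eq_char_mul]
      calc (∫ k, ((𝐞 (k * x) : Circle) : ℂ) * ((ρr n k : ℝ) : ℂ)) - 1
          = (∫ k, ((𝐞 (k * x) : Circle) : ℂ) * ((ρr n k : ℝ) : ℂ)) - ∫ k, ((ρr n k : ℝ) : ℂ) := by rw [h1]
        _ = ∫ k, ((((𝐞 (k * x) : Circle) : ℂ) * ((ρr n k : ℝ) : ℂ)) - ((ρr n k : ℝ) : ℂ)) :=
            (integral_sub hci hρi).symm
        _ = _ := integral_congr_ae (ae_of_all _ fun k => by ring)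
    rw [hrepr]
    refine (norm_integral_le_integral_norm _).trans ?_
    -- pointwise: the integrand is supported where `|k| ≤ 3/(n+1)`
    have hpt : ∀ k, ‖(((𝐞 (k * x) : Circle) : ℂ) - 1) * ((ρr n k : ℝ) : ℂ)‖
        ≤ (2 * π * |x| * (3 / ((n : ℝ) + 1))) * ρr n k := by
      intro k
      rw [norm_mul, Complex.norm_real, Real.norm_eq_abs, abs_of_nonneg ((b n).nonneg_normed k)]
      by_cases hk : ρr n k = 0
      · have hk' : (b n).normed volume k = 0 := hk
        rw [hk]; simp [hk']
      · have hmem : k ∈ Metric.ball ((2 : ℝ) / ((n : ℝ) + 1)) (b n).rOut := by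
          rw [← (b n).support_normed_eq (μ := volume)]; exact hk
        rw [Metric.mem_ball, Real.dist_eq, hb n] at hmem
        have hkabs : |k| ≤ 3 / ((n : ℝ) + 1) := by
          have h3 : (3 : ℝ) / ((n : ℝ) + 1) = 2 / ((n : ℝ) + 1) + 1 / ((n : ℝ) + 1) := by ring
          rw [h3]
          have := abs_sub_abs_le_abs_sub k (2 / ((n : ℝ) + 1))
          rw [abs_of_pos (show (0:ℝ) < 2 / ((n : ℝ) + 1) by positivity)] at this
          linarith
        have hchar : ‖((𝐞 (k * x) : Circle) : ℂ) - 1‖ ≤ 2 * π * |x| * (3 / ((n : ℝ) + 1)) := by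
          refine (norm_fourierChar_sub_one_le (k * x)).trans ?_
          rw [abs_mul, mul_comm |k| |x|, ← mul_assoc]
          gcongr
        exact mul_le_mul_of_nonneg_right hchar ((b n).nonneg_normed k)
    refine (integral_mono_of_nonneg (ae_of_all _ fun k => norm_nonneg _) ?_ (ae_of_all _ hpt)).trans ?_
    · exact ((b n).integrable_normed.const_mul _)
    · rw [integral_const_mul, hρr, (b n).integral_normed, mul_one]
  · -- `𝓕ψ_n = ρ_n`
    intro n
    rw [hψ_eq n]
    have hcont : Continuous (fun k => ((ρr n k : ℝ) : ℂ)) := Complex.continuous_ofReal.comp (b n).continuous_normed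
    have hint1 : Integrable (fun k => ((ρr n k : ℝ) : ℂ)) := by simpa [hρS_coe] using (ρS n).integrable
    have hint2 : Integrable (𝓕 (fun k => ((ρr n k : ℝ) : ℂ))) := by
      have : 𝓕 (fun k => ((ρr n k : ℝ) : ℂ)) = ((𝓕 (ρS n) : 𝓢(ℝ, ℂ)) : ℝ → ℂ) := by
        rw [SchwartzMap.fourier_coe, hρS_coe]
      rw [this]; exact (𝓕 (ρS n)).integrable
    exact hcont.fourier_fourierInv_eq hint1 hint2
  · -- `ρ_n = 0` on `(−∞, 0]`
    intro n k hk
    have hnot : k ∉ Function.support (ρr n) := by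
      rw [hρr, (b n).support_normed_eq (μ := volume), Metric.mem_ball, Real.dist_eq, hb n, not_lt]
      have h1 : (0 : ℝ) < 1 / ((n : ℝ) + 1) := by positivity
      have h2 : (2 : ℝ) / ((n : ℝ) + 1) = 2 * (1 / ((n : ℝ) + 1)) := by ring
      rw [abs_of_nonpos (by linarith)]
      linarith
    have : ρr n k = 0 := Function.notMem_support.mp hnot
    simp [this]

/-! ### The square of the analytic signal has no negative frequencies -/

/-- If `W = 𝓕⁻G` pointwise with `G ∈ L¹` vanishing on `(−∞,0)`, and `W ∈ L²`, then `𝓕(W²)(k) = 0` for every `k ≤ 0`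
(analytic regularisation + `𝓕(𝓕⁻G·h) = G ⋆ 𝓕h` twice + dominated convergence). [folklore] -/
private theorem fourier_sq_eq_zero_of_nonpos {W G : ℝ → ℂ} (hGi : Integrable G) (hG0 : ∀ s < 0, G s = 0)
    (hW : ∀ x, W x = 𝓕⁻ G x) (hWc : Continuous W) (hW2 : MemLp W 2) {k : ℝ} (hk : k ≤ 0) :
    𝓕 (fun x => W x * W x) k = 0 := by
  obtain ⟨ψ, ρ, hψc, hψi, hψ2, hψ1, hψlim, hρi, hFψ, hρ0⟩ := exists_analyticRegularisers
  -- the regularised products and their Fourier transforms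
  have hWψ2 : ∀ n, MemLp (fun x => W x * ψ n x) 2 := fun n =>
    MemLp.of_le hW2 (hWc.mul (hψc n)).aestronglyMeasurable
      (ae_of_all _ fun x => by
        rw [norm_mul]; exact mul_le_of_le_one_right (norm_nonneg _) (hψ1 n x))
  have hWψi : ∀ n, Integrable (fun x => W x * ψ n x) := fun n => hW2.integrable_mul (hψ2 n)
  have hWWψi : ∀ n, Integrable (fun x => W x * (W x * ψ n x)) := fun n => hW2.integrable_mul (hWψ2 n)
  have hF1 : ∀ n, 𝓕 (fun x => W x * ψ n x) = G ⋆[ContinuousLinearMap.mul ℂ ℂ] ρ n := by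
    intro n
    have h := fourier_fourierInv_mul_eq_convolution hGi (hψi n)
    rw [hFψ n] at h
    rw [← h]; congr 1; funext x; rw [hW x]
  have hF2 : ∀ n, 𝓕 (fun x => W x * (W x * ψ n x))
      = G ⋆[ContinuousLinearMap.mul ℂ ℂ] (G ⋆[ContinuousLinearMap.mul ℂ ℂ] ρ n) := by
    intro n
    have h := fourier_fourierInv_mul_eq_convolution hGi (hWψi n)
    rw [hF1 n] at h
    rw [← h]; congr 1; funext x; rw [hW x]
  -- vanishing on `k ≤ 0`
  have hzero : ∀ n, 𝓕 (fun x => W x * (W x * ψ n x)) k = 0 := by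
    intro n
    rw [hF2 n]
    refine convolution_eq_zero_of_le hG0 (fun t ht => ?_) hk
    exact convolution_eq_zero_of_le hG0 (fun t' ht' => hρ0 n t' ht') ht
  -- dominated convergence `ψ_n → 1`
  have hWWi : Integrable (fun x => W x * W x) := hW2.integrable_mul hW2
  have hlim : Tendsto (fun n => 𝓕 (fun x => W x * (W x * ψ n x)) k) atTop (𝓝 (𝓕 (fun x => W x * W x) k)) := by
    simp only [Real.fourier_real_eq, Circle.smul_def, smul_eq_mul]
    refine tendsto_integral_of_dominated_convergence (fun x => ‖W x * W x‖) ?_ hWWi.norm ?_ ?_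
    · intro n; exact (integrable_char_mul (hWWψi n) k).1
    · intro n
      refine ae_of_all _ fun x => ?_
      rw [norm_mul, Circle.norm_coe, one_mul, norm_mul, norm_mul, norm_mul]
      have h0 : 0 ≤ ‖W x‖ := norm_nonneg _
      calc ‖W x‖ * (‖W x‖ * ‖ψ n x‖) ≤ ‖W x‖ * (‖W x‖ * 1) := by gcongr; exact hψ1 n x
        _ = ‖W x‖ * ‖W x‖ := by ring
    · refine ae_of_all _ fun x => ?_
      have h := ((hψlim x).const_mul (W x)).const_mul (W x)
      rw [mul_one] at h
      exact h.const_mul _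
  exact tendsto_nhds_unique hlim (tendsto_const_nhds.congr fun n => (hzero n).symm)

/-! ### The product rule -/

/-- **Tricomi–Cotlar product rule `H(f·Hf) = ½((Hf)² − f²)` on the line.** Let `f : ℝ → ℝ` be continuous, bounded, in
`L¹ ∩ L²`, with symmetric p.v. integrand integrable at a.e. point, with `Hf` continuous and `𝓕f ∈ L¹`; assume also that
`B := 2f·Hf` has a.e.-integrable symmetric p.v. integrand and continuous Hilbert transform. Then for every `x`
`H(f·Hf)(x) = ((Hf)(x)² − f(x)²)/2`. (Equivalently: `W = f + iHf` has `W²` again of the form `A + iHA`.)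
[cite: King2009HilbertTransforms2, eqs. (19.283)–(19.284) (squared analytic signal; from Tricomi's identity, Vol. 1
eq. (4.270))] -/
theorem hilbertTransform_mul_hilbertTransform {f : ℝ → ℝ} {C₀ : ℝ} (hfc : Continuous f) (hf : Integrable f)
    (hf2 : MemLp f 2) (hfb : ∀ x, |f x| ≤ C₀)
    (hint : ∀ᵐ x : ℝ, IntegrableOn (fun t => (f (x - t) - f (x + t)) / t) (Ioi 0))
    (hHc : Continuous (hilbertTransform f)) (hFf : Integrable (𝓕 (fun x => (f x : ℂ))))
    (hintB : ∀ᵐ x : ℝ, IntegrableOn (fun t => ((2 * f (x - t) * hilbertTransform f (x - t))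
        - (2 * f (x + t) * hilbertTransform f (x + t))) / t) (Ioi 0))
    (hHBc : Continuous (hilbertTransform (fun y => 2 * f y * hilbertTransform f y))) (x : ℝ) :
    hilbertTransform (fun y => f y * hilbertTransform f y) x = (hilbertTransform f x ^ 2 - f x ^ 2) / 2 := by
  set h : ℝ → ℝ := hilbertTransform f with hh
  -- `h ∈ L²`
  have hh2 : MemLp h 2 := memLp_two_hilbertTransform hf hf2 hint
  -- the analytic signal `W = f + ih = 𝓕⁻G`
  set G : ℝ → ℂ := fun k => (1 + ((Real.sign k : ℝ) : ℂ)) * 𝓕 (fun y => (f y : ℂ)) k with hG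
  set W : ℝ → ℂ := fun x => (f x : ℂ) + I * h x with hW
  have hWG : ∀ x, W x = 𝓕⁻ G x := fun x => analyticSignal_eq_fourierInv hfc hf hf2 hint hHc hFf x
  have hGi : Integrable G := by
    refine (hFf.norm.const_mul 2).mono' ?_ (ae_of_all _ fun k => ?_)
    · have hms : Measurable fun k : ℝ => ((Real.sign k : ℝ) : ℂ) :=
        Complex.measurable_ofReal.comp measurable_real_sign'
      exact ((hms.const_add 1).aestronglyMeasurable.mul hFf.1)
    · simp only [hG, norm_mul]
      have hs : ‖(1 : ℂ) + ((Real.sign k : ℝ) : ℂ)‖ ≤ 2 := by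
        rcases lt_trichotomy k 0 with hk | rfl | hk
        · rw [Real.sign_of_neg hk]; simp
        · rw [Real.sign_zero]; simp
        · rw [Real.sign_of_pos hk]; norm_num
      exact mul_le_mul_of_nonneg_right hs (norm_nonneg _)
  have hG0 : ∀ s < 0, G s = 0 := fun s hs => by simp [hG, Real.sign_of_neg hs]
  have hWc : Continuous W :=
    (Complex.continuous_ofReal.comp hfc).add (continuous_const.mul (Complex.continuous_ofReal.comp hHc))
  have hf2ℂ : MemLp (fun x => (f x : ℂ)) 2 :=
    MemLp.of_le hf2 (Complex.continuous_ofReal.comp_aestronglyMeasurable hf2.1) (ae_of_all _ fun x => by simp)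
  have hh2ℂ : MemLp (fun x => (h x : ℂ)) 2 :=
    MemLp.of_le hh2 (Complex.continuous_ofReal.comp_aestronglyMeasurable hh2.1) (ae_of_all _ fun x => by simp)
  have hW2 : MemLp W 2 := hf2ℂ.add (hh2ℂ.const_mul I)
  -- `𝓕(W²) = 0` on `k ≤ 0`
  have hsq0 : ∀ k ≤ 0, 𝓕 (fun x => W x * W x) k = 0 := fun k hk =>
    fourier_sq_eq_zero_of_nonpos hGi hG0 hWG hWc hW2 hk
  -- `W² = A + iB`
  set A : ℝ → ℝ := fun x => f x ^ 2 - h x ^ 2 with hA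
  set B : ℝ → ℝ := fun x => 2 * f x * h x with hB
  have hC₀ : 0 ≤ C₀ := (abs_nonneg _).trans (hfb 0)
  have hfh : Integrable (fun x => f x * h x) := hf2.integrable_mul hh2
  have hAi : Integrable A := (hf2.integrable_sq).sub (hh2.integrable_sq)
  have hBi : Integrable B := by
    have := hfh.const_mul 2; refine this.congr (ae_of_all _ fun x => ?_); simp only [hB]; ring
  have hB2 : MemLp B 2 := by
    refine MemLp.of_le (hh2.const_mul (2 * C₀)) ?_ (ae_of_all _ fun x => ?_)
    · exact ((continuous_const.mul hfc).mul hHc).aestronglyMeasurable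
    · simp only [hB, Real.norm_eq_abs, abs_mul, abs_two, abs_of_nonneg hC₀]
      have := hfb x
      have h0 : 0 ≤ |h x| := abs_nonneg _
      gcongr
  have hWW : ∀ x, W x * W x = (A x : ℂ) + I * (B x : ℂ) := by
    intro x
    simp only [hW, hA, hB]
    push_cast
    have hI : I * I = -1 := Complex.I_mul_I
    linear_combination ((h x : ℂ) ^ 2) * hI
  have hFsplit : ∀ k, 𝓕 (fun x => W x * W x) k = 𝓕 (fun x => (A x : ℂ)) k + I * 𝓕 (fun x => (B x : ℂ)) k := by
    intro k
    rw [Real.fourier_real_eq, Real.fourier_real_eq, Real.fourier_real_eq]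
    have iA : Integrable (fun v : ℝ => (𝐞 (-(v * k))) • ((A v : ℝ) : ℂ)) := integrable_char_smul hAi.ofReal k
    have iB : Integrable (fun v : ℝ => I * ((𝐞 (-(v * k))) • ((B v : ℝ) : ℂ))) :=
      (integrable_char_smul hBi.ofReal k).const_mul I
    have e1 : ∀ v : ℝ, (𝐞 (-(v * k))) • (W v * W v)
        = (𝐞 (-(v * k))) • ((A v : ℝ) : ℂ) + I * ((𝐞 (-(v * k))) • ((B v : ℝ) : ℂ)) := by
      intro v; rw [hWW v, smul_add, mul_smul_comm]
    refine (integral_congr_ae (ae_of_all _ e1)).trans ?_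
    rw [integral_add iA iB, integral_const_mul]
  -- `𝓕A = −(−i sgn)·𝓕B` off `k = 0`
  have hrel : ∀ k, k ≠ 0 → 𝓕 (fun x => (A x : ℂ)) k
      = -(((((-Real.sign k) : ℝ) : ℂ) * I) * 𝓕 (fun x => (B x : ℂ)) k) := by
    intro k hk
    rcases lt_or_gt_of_ne hk with hk | hk
    · have h0 := hsq0 k hk.le
      rw [hFsplit] at h0
      rw [Real.sign_of_neg hk]; push_cast
      linear_combination h0
    · have hnk : -k < 0 := by linarith
      have h0 := hsq0 (-k) hnk.le
      rw [hFsplit, fourier_ofReal_neg, fourier_ofReal_neg] at h0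
      -- conjugate the relation at `−k`
      have h1 := congrArg (starRingEnd ℂ) h0
      simp only [map_add, map_mul, Complex.conj_conj, Complex.conj_I, map_zero] at h1
      rw [Real.sign_of_pos hk]; push_cast
      linear_combination h1
  -- the tested identity for `B` and the pairing of `A`
  have hann : ∀ θ : 𝓢(ℝ, ℂ), ∫ y, ((hilbertTransform B y + A y : ℝ) : ℂ) * 𝓕 (θ : ℝ → ℂ) y = 0 := by
    intro θ
    have hθi : Integrable (θ : ℝ → ℂ) := θ.integrable
    have hFθ2 : MemLp (𝓕 (θ : ℝ → ℂ)) 2 := by rw [← SchwartzMap.fourier_coe]; exact (𝓕 θ).memLp 2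
    have hFθi : Integrable (𝓕 (θ : ℝ → ℂ)) := by rw [← SchwartzMap.fourier_coe]; exact (𝓕 θ).integrable
    have eB := integral_hilbertTransform_mul_fourier_eq hBi hB2 hintB hθi hFθ2
    have eA : ∫ y, (A y : ℂ) * 𝓕 (θ : ℝ → ℂ) y = ∫ k, 𝓕 (fun y => (A y : ℂ)) k * θ k :=
      (integral_fourier_mul_eq_flip hAi.ofReal hθi).symm
    -- integrability of the two pairings in `y`
    have hHB2 : MemLp (fun y => (hilbertTransform B y : ℂ)) 2 := by
      have h := memLp_two_hilbertTransform hBi hB2 hintB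
      exact MemLp.of_le h (Complex.continuous_ofReal.comp_aestronglyMeasurable h.1) (ae_of_all _ fun x => by simp)
    have hiHB : Integrable fun y => (hilbertTransform B y : ℂ) * 𝓕 (θ : ℝ → ℂ) y := hHB2.integrable_mul hFθ2
    have hθb : ∀ y, ‖𝓕 (θ : ℝ → ℂ) y‖ ≤ ∫ v, ‖(θ : ℝ → ℂ) v‖ := fun y =>
      VectorFourier.norm_fourierIntegral_le_integral_norm 𝐞 volume (innerₗ ℝ) _ y
    have hiA : Integrable fun y => (A y : ℂ) * 𝓕 (θ : ℝ → ℂ) y :=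
      hAi.ofReal.mul_bdd (by rw [← SchwartzMap.fourier_coe]; exact (𝓕 θ).continuous.aestronglyMeasurable)
        (ae_of_all _ hθb)
    -- a.e. equality of the Fourier-side integrands (off `k = 0`)
    have hFA : Continuous (𝓕 (fun y => (A y : ℂ))) := continuous_fourierIntegral hAi.ofReal
    have hiFA : Integrable fun k => 𝓕 (fun y => (A y : ℂ)) k * θ k := by
      have hb : ∀ k, ‖𝓕 (fun y => (A y : ℂ)) k‖ ≤ ∫ v, ‖(A v : ℂ)‖ := fun k =>
        VectorFourier.norm_fourierIntegral_le_integral_norm 𝐞 volume (innerₗ ℝ) _ k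
      exact hθi.bdd_mul hFA.aestronglyMeasurable (ae_of_all _ hb)
    have hae : (fun k => ((((-Real.sign k) : ℝ) : ℂ) * I) * 𝓕 (fun y => (B y : ℂ)) k * θ k)
        =ᵐ[volume] fun k => -(𝓕 (fun y => (A y : ℂ)) k * θ k) := by
      have h0 : ∀ᵐ k ∂(volume : Measure ℝ), k ∉ ({0} : Set ℝ) :=
        measure_eq_zero_iff_ae_notMem.mp (measure_singleton 0)
      filter_upwards [h0] with k hk
      rw [hrel k hk]; ring
    have esum : ∫ y, ((hilbertTransform B y + A y : ℝ) : ℂ) * 𝓕 (θ : ℝ → ℂ) y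
        = (∫ y, (hilbertTransform B y : ℂ) * 𝓕 (θ : ℝ → ℂ) y) + ∫ y, (A y : ℂ) * 𝓕 (θ : ℝ → ℂ) y := by
      rw [← integral_add hiHB hiA]
      refine integral_congr_ae (ae_of_all _ fun y => ?_); push_cast; ring
    rw [esum, eB, eA, integral_congr_ae hae, integral_neg, neg_add_cancel]
  -- conclude: `HB + A ≡ 0`
  have hcont : Continuous fun y => ((hilbertTransform B y + A y : ℝ) : ℂ) :=
    Complex.continuous_ofReal.comp (hHBc.add ((hfc.pow 2).sub (hHc.pow 2)))
  have hzero := eq_zero_of_forall_integral_mul_fourier_schwartz hcont hann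
  have hx := congrFun hzero x
  simp only [Pi.zero_apply, Complex.ofReal_eq_zero] at hx
  -- `HB = 2·H(f·h)`
  have hHB : hilbertTransform B x = 2 * hilbertTransform (fun y => f y * h y) x := by
    rw [← hilbertTransform_const_mul]; simp only [hB, mul_assoc]
  rw [hHB] at hx
  simp only [hA] at hx
  linarith

end Literature.Analysis.Fourier
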